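import Mathlib
import Literature.Probability.RandomPlanarGeometry.ChordalCurveFamilyProofs
import HarnessLib

/-!
# Rigidity of simple curve classes

Crux `AxiomsOfLimit` (stmt-CriticalPhenomena-1370), line `registered`, stub `stub_markovOfLimit`:
soft-Markov brick "rigidity of simple classes" (lead c4); registered sub-stub
`stub_simpleClassRigidity`. Theorems only.

A curve `γ'` at reparametrisation distance `0` from an INJECTIVE curve `γ` is `γ` precomposed
with a continuous monotone surjection `ψ` of `[0, 1]` ("every representative of a simple class
is the injective one, run with pauses"). This makes constructions through a representative (the
intrinsic clock of the soft-Markov line) representative-independent on simple classes, once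
they are invariant under monotone reparametrisations with pauses.

## The argument

Choose increasing homeomorphisms `φₙ` of `[0, 1]` with `sup_t dist (γ' t) (γ (φₙ t)) < 1/(n+1)`
(`Curve.exists_dist_reparam_lt`). The continuous injection `γ` of the compact interval into the
Hausdorff space `E` is a closed embedding; the traces of `γ` and `γ'` coincide
(`Curve.range_eq_of_dist_eq_zero`), so `γ' t = γ (ψ t)` for a unique `ψ t`, and `ψ` is continuous.
Since `γ (φₙ t) → γ' t = γ (ψ t)`, the embedding property gives `φₙ t → ψ t` pointwise; hence `ψ`
is monotone with `ψ 0 = 0`, `ψ 1 = 1` as a pointwise limit of increasing bijections, and it is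
onto by the intermediate value theorem.

References: M. Aizenman, A. Burchard, Duke Math. J. 99 (1999), §2.1 (the curve space). The
statement itself is folklore. All [folklore].
-/

noncomputable section

open Filter Topology Set Metric
open scoped unitInterval

namespace Summit.CriticalPhenomena.SAWScalingLimit.Theorems.AxiomsOfLimitMarkov

open Literature.Probability.RandomPlanarGeometry

/-- **Rigidity of simple classes, general form.** In a metric space `E`, a curve `γ'` at
reparametrisation distance `0` from an injective curve `γ` factors as `γ' = γ ∘ ψ` through a
continuous monotone surjection `ψ : [0,1] → [0,1]` with `ψ 0 = 0`, `ψ 1 = 1`. [folklore] -/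
theorem SimpleRigidity.exists_monotone_factor {E : Type*} [MetricSpace E] {γ γ' : Curve E}
    (hinj : Function.Injective γ) (h : dist γ' γ = 0) :
    ∃ ψ : I → I, Continuous ψ ∧ Monotone ψ ∧ ψ 0 = 0 ∧ ψ 1 = 1 ∧ Function.Surjective ψ ∧
      ∀ t, γ' t = γ (ψ t) := by
  -- reparametrisations realising sup distance `< 1/(n+1)`
  have hpos : ∀ n : ℕ, dist γ' γ < 1 / ((n : ℝ) + 1) := fun n => by rw [h]; positivity
  choose φ hφ using fun n => Curve.exists_dist_reparam_lt (hpos n)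
  have hclose : ∀ n (t : I), dist (γ' t) (γ (φ n t)) < 1 / ((n : ℝ) + 1) := fun n t =>
    (ContinuousMap.dist_apply_le_dist (f := γ'.toContinuousMap)
      (g := (γ.reparam (φ n)).toContinuousMap) t).trans_lt (hφ n)
  -- `γ` is a closed embedding of `[0, 1]` into `E`
  have hemb : IsClosedEmbedding γ := γ.continuous.isClosedEmbedding hinj
  -- every point of `γ'` is a point of `γ`; `ψ t` is its (unique) parameter
  have hmem : ∀ t, ∃ s, γ s = γ' t := fun t => by
    have ht : γ' t ∈ γ.range := by
      rw [← Curve.range_eq_of_dist_eq_zero h]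
      exact ⟨t, rfl⟩
    exact Curve.mem_range.1 ht
  choose ψ hψ using hmem
  -- `φₙ t → ψ t`
  have htend : ∀ t, Tendsto (fun n => φ n t) atTop (𝓝 (ψ t)) := by
    intro t
    rw [hemb.tendsto_nhds_iff]
    show Tendsto (fun n => γ (φ n t)) atTop (𝓝 (γ (ψ t)))
    rw [hψ, tendsto_iff_dist_tendsto_zero]
    refine squeeze_zero (fun _ => dist_nonneg) (fun n => ?_)
      tendsto_one_div_add_atTop_nhds_zero_nat
    rw [dist_comm]
    exact (hclose n t).le
  -- continuity, monotonicity, endpoints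
  have hψc : Continuous ψ := by
    rw [hemb.continuous_iff]
    have hcomp : γ ∘ ψ = γ' := funext hψ
    rw [hcomp]
    exact γ'.continuous
  have hψm : Monotone ψ := fun s t hst =>
    le_of_tendsto_of_tendsto' (htend s) (htend t) fun n => (φ n).monotone hst
  have hψ0 : ψ 0 = 0 := by
    refine tendsto_nhds_unique (htend 0) ?_
    have h0 : ∀ n, φ n 0 = 0 := fun n => by
      rw [show (0 : I) = ⊥ from rfl]
      exact (φ n).map_bot
    simp only [h0]
    exact tendsto_const_nhds
  have hψ1 : ψ 1 = 1 := by
    refine tendsto_nhds_unique (htend 1) ?_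
    have h1 : ∀ n, φ n 1 = 1 := fun n => by
      rw [show (1 : I) = ⊤ from rfl]
      exact (φ n).map_top
    simp only [h1]
    exact tendsto_const_nhds
  -- surjectivity by the intermediate value theorem
  have hψs : Function.Surjective ψ := fun s => by
    have hs : s ∈ Icc (ψ 0) (ψ 1) := by
      rw [hψ0, hψ1]
      exact ⟨unitInterval.nonneg', unitInterval.le_one'⟩
    exact intermediate_value_univ 0 1 hψc hs
  exact ⟨ψ, hψc, hψm, hψ0, hψ1, hψs, fun t => (hψ t).symm⟩

/-- **Rigidity of simple classes** (crux `AxiomsOfLimit`, registered stub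
`stub_simpleClassRigidity`): a planar curve at reparametrisation distance `0` from an injective
curve `γ` is `γ ∘ ψ` for a continuous monotone surjection `ψ` of `[0, 1]` with `ψ 0 = 0`,
`ψ 1 = 1`. [folklore] -/
theorem stub_simpleClassRigidity : ∀ (γ γ' : Literature.Probability.RandomPlanarGeometry.Curve ℂ), Function.Injective γ → dist γ' γ = 0 → ∃ ψ : unitInterval → unitInterval, Continuous ψ ∧ Monotone ψ ∧ ψ 0 = 0 ∧ ψ 1 = 1 ∧ Function.Surjective ψ ∧ ∀ t, γ' t = γ (ψ t) :=
  fun _ _ hinj h => SimpleRigidity.exists_monotone_factor hinj h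

end Summit.CriticalPhenomena.SAWScalingLimit.Theorems.AxiomsOfLimitMarkov
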